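import Summits.QuantumFields.YangMills.Theorems.LangevinControlUVFemtoCurvatureTwoPointStrictRPSliceKernel
import Summits.QuantumFields.YangMills.Theorems.LangevinControlUVFemtoCurvatureTwoPointStrictRPSiteGeometry
import Literature.MathematicalPhysics.QuantumLattice.GrassmannIntegralWilsonProofs

/-!
# Crux `FemtoCurvatureTwoPoint` (stmt-QuantumFields-9363, route `LangevinControlUV`):
# strict positivity of the axis covariance, VI — the lowest transfer step is a slice kernel

Helper for the registered sub-goal `stub_axisPositive` (`--supports stmt-QuantumFields-9363`).
The site-positive part `A'` of the Wilson action splits as the lowest transfer step (temporal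
plaquettes based at `t = 0`, `lowAction`) plus the rest (`restAction`). On the configuration
`lowSplice V W Y` (site-positive links from `W`, temporal links `0 → 1` resampled from `Y`,
boundary from `V`) each low plaquette is ONE Gram factor `⟪ρ(V(y,i)), ρ((W^{γ_Y})(y + e₀, i))⟫`
(`plaqRe_lowSplice_of_isLowPlaq`: unitarity `ρ(g⁻¹) = ρ(g)ᴴ`, tree `unitaryRep_inv_eq_conjTranspose`), so that
`exp(β · lowAction) = K_{E₁}(shiftDown V, W^{γ_Y})` (`exp_lowAction_lowSplice`), the slice kernel of
the slice `t = 1` composed with the gauge transformation `γ_Y` built from the temporal links.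
Also: what the rest of the action and a spatial plaquette at time `1` read, the real slab functional
`chiR`, the rest weight `restWeight` and the boundary configurations `bottomConfig`.
-/

set_option autoImplicit false

noncomputable section

namespace Summit.QuantumFields.YangMills.Theorems.FemtoCurvatureTwoPoint.StrictRP

open MeasureTheory Finset
open scoped Matrix ComplexConjugate
open Literature.MathematicalPhysics.QuantumFieldTheory

section Transfer

variable {d L N : ℕ} [NeZero d] [NeZero L] [Fact (1 < L)] {G : Type*} [Group G]
  [TopologicalSpace G] [IsTopologicalGroup G] [CompactSpace G] [MeasurableSpace G] [BorelSpace G]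
  (ρ : G →* Matrix (Fin N) (Fin N) ℂ)



omit [TopologicalSpace G] [IsTopologicalGroup G] [CompactSpace G] [MeasurableSpace G] [BorelSpace G] in
/-- `A' = (lowest transfer step) + (rest)`. [folklore] -/
theorem sitePosAction_eq_add (U : GaugeConfig d L G) :
    WilsonSiteRP.sitePosAction ρ U = lowAction ρ U + restAction ρ U := by
  unfold WilsonSiteRP.sitePosAction lowAction restAction
  rw [← Finset.sum_filter_add_sum_filter_not (univ.filter WilsonSiteRP.IsSitePosPlaq) IsLowPlaq]
  congr 1
  refine Finset.sum_congr ?_ fun _ _ => rfl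
  ext p
  simp only [Finset.mem_filter, Finset.mem_univ, true_and]
  exact ⟨fun h => h.2, fun h => ⟨isSitePosPlaq_of_isLowPlaq h, h⟩⟩

omit [NeZero d] [NeZero L] [Fact (1 < L)] [TopologicalSpace G] [IsTopologicalGroup G] [CompactSpace G]
  [MeasurableSpace G] [BorelSpace G] in
/-- The pairing is symmetric. [folklore] -/
theorem pairing_comm (g h : G) : pairing ρ g h = pairing ρ h g := by
  rw [pairing_eq_sum, pairing_eq_sum]
  exact Finset.sum_congr rfl fun a _ => Finset.sum_congr rfl fun b _ => by ring

omit [NeZero d] [NeZero L] [Fact (1 < L)] [TopologicalSpace G] [IsTopologicalGroup G] [CompactSpace G]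
  [MeasurableSpace G] [BorelSpace G] in
/-- `Re tr ρ(k b⁻¹) = ⟪ρ(b), ρ(k)⟫` for a unitary representation. [folklore] -/
theorem re_trace_mul_inv (hunit : ∀ g, ρ g ∈ Matrix.unitaryGroup (Fin N) ℂ) (k b : G) :
    (ρ (k * b⁻¹)).trace.re = pairing ρ b k := by
  rw [map_mul, Literature.MathematicalPhysics.QuantumLattice.unitaryRep_inv_eq_conjTranspose ρ hunit, pairing_comm]
  rfl


omit [TopologicalSpace G] [IsTopologicalGroup G] [CompactSpace G] [MeasurableSpace G] [BorelSpace G] in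
/-- **One low plaquette is one Gram factor**: for a low plaquette `p = (y; 0, i)`,
`Re tr ρ(U_p) = ⟪ρ(V(y,i)), ρ((W^{γ_Y})(y + e₀, i))⟫` on the configuration `lowSplice V W Y`
(`L ≥ 4`). [folklore] -/
theorem plaqRe_lowSplice_of_isLowPlaq (hL4 : 4 ≤ L)
    (hunit : ∀ g, ρ g ∈ Matrix.unitaryGroup (Fin N) ℂ)
    (V W Y : GaugeConfig d L G) {p : Plaquette d L} (hp : IsLowPlaq p) :
    WilsonRP.plaqRe ρ (lowSplice V W Y) p =
      pairing ρ (V (p.1, p.2.1.2)) (gaugeTransform (gaugeOf Y) W (p.1.shift 0, p.2.1.2)) := by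
  obtain ⟨he1, he2, he3, he4⟩ := edges_of_isLowPlaq hp
  have hi : p.2.1.1 = 0 := hp.1
  rw [hi] at he1 he2 he3
  have ht : (p.1 0).val = 0 := hp.2
  have hj : p.2.1.2 ≠ 0 := WilsonRP.plaq_snd_ne_zero p
  -- membership of the four links
  have hP1 : (p.1, (0 : Fin d)) ∈ (WilsonSiteRP.sitePosEdges : Finset (Edge d L)) :=
    WilsonSiteRP.mem_sitePosEdges.2 (isSitePosEdge_of_mem_lowEdges he1)
  have hP3 : (p.1.shift p.2.1.2, (0 : Fin d)) ∈ (WilsonSiteRP.sitePosEdges : Finset (Edge d L)) :=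
    WilsonSiteRP.mem_sitePosEdges.2 (isSitePosEdge_of_mem_lowEdges he3)
  have hP2 : (p.1.shift 0, p.2.1.2) ∈ (WilsonSiteRP.sitePosEdges : Finset (Edge d L)) :=
    WilsonSiteRP.mem_sitePosEdges.2 (isSitePosEdge_of_mem_sliceOneEdges hL4 he2)
  have hP4 : (p.1, p.2.1.2) ∉ (WilsonSiteRP.sitePosEdges : Finset (Edge d L)) := fun h =>
    not_isSitePosEdge_of_mem_bottomEdges he4 (WilsonSiteRP.mem_sitePosEdges.1 h)
  have hT2 : (p.1.shift 0, p.2.1.2) ∉ (lowEdges : Finset (Edge d L)) := fun h =>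
    hj (mem_lowEdges.1 h).1
  -- the four link values
  have v1 : lowSplice V W Y (p.1, 0) = Y (p.1, 0) := by
    simp only [lowSplice, LatticeRP.splice_apply, if_pos hP1, if_pos he1]
  have v2 : lowSplice V W Y (p.1.shift 0, p.2.1.2) = W (p.1.shift 0, p.2.1.2) := by
    simp only [lowSplice, LatticeRP.splice_apply, if_pos hP2, if_neg hT2]
  have v3 : lowSplice V W Y (p.1.shift p.2.1.2, 0) = Y (p.1.shift p.2.1.2, 0) := by
    simp only [lowSplice, LatticeRP.splice_apply, if_pos hP3, if_pos he3]
  have v4 : lowSplice V W Y (p.1, p.2.1.2) = V (p.1, p.2.1.2) := by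
    simp only [lowSplice, LatticeRP.splice_apply, if_neg hP4]
  -- the gauge function at the two ends of the slice-one link
  have ht1 : ((p.1.shift 0) 0).val = 1 := val_shift_zero_of_val_eq_zero ht
  have ht1' : (((p.1.shift 0).shift p.2.1.2) 0).val = 1 := by
    rw [WilsonRP.val_shift_of_ne _ hj.symm]; exact ht1
  have g1 : gaugeOf Y (p.1.shift 0) = Y (p.1, 0) := by
    rw [gaugeOf_of_eq Y ht1]
    simp [Site.shift]
  have g2 : gaugeOf Y ((p.1.shift 0).shift p.2.1.2) = Y (p.1.shift p.2.1.2, 0) := by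
    rw [gaugeOf_of_eq Y ht1']
    congr 1
    simp only [Site.shift]
    abel
  unfold WilsonRP.plaqRe plaquetteHolonomy
  rw [hi, v1, v2, v3, v4, re_trace_mul_inv ρ hunit]
  simp only [gaugeTransform, g1, g2]


omit [TopologicalSpace G] [IsTopologicalGroup G] [CompactSpace G] [MeasurableSpace G] [BorelSpace G] in
/-- **The lowest transfer step is the slice kernel of the slice `t = 1`**:
`exp(β · lowAction (lowSplice V W Y)) = K_{E₁}(shiftDown V, W^{γ_Y})`. [folklore] -/
theorem exp_lowAction_lowSplice (hL4 : 4 ≤ L) (hunit : ∀ g, ρ g ∈ Matrix.unitaryGroup (Fin N) ℂ)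
    (β : ℝ) (V W Y : GaugeConfig d L G) :
    Real.exp (β * lowAction ρ (lowSplice V W Y)) =
      sliceKernel ρ β sliceOneEdges (shiftDown V) (gaugeTransform (gaugeOf Y) W) := by
  unfold sliceKernel lowAction
  congr 2
  refine Finset.sum_bij (fun (p : Plaquette d L) _ => ((p.1.shift 0, p.2.1.2) : Edge d L))
    ?_ ?_ ?_ ?_
  · intro p hp
    have hp' : IsLowPlaq p := (Finset.mem_filter.1 hp).2
    have := (edges_of_isLowPlaq hp').2.1
    rwa [hp'.1] at this
  · intro p hp p' hp' h
    have hl : IsLowPlaq p := (Finset.mem_filter.1 hp).2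
    have hl' : IsLowPlaq p' := (Finset.mem_filter.1 hp').2
    obtain ⟨h1, h2⟩ := Prod.mk.inj h
    have hx : p.1 = p'.1 := by
      have := congrArg (fun x : Site d L => x - Pi.single 0 1) h1
      simpa [Site.shift] using this
    refine Prod.ext hx (Subtype.ext (Prod.ext ?_ h2))
    rw [hl.1, hl'.1]
  · intro e he
    obtain ⟨hj, h1⟩ := mem_sliceOneEdges.1 he
    have hpos : (0 : Fin d) < e.2 := (Fin.pos_iff_ne_zero' e.2).2 hj
    refine ⟨((e.1 - Pi.single 0 1, ⟨((0 : Fin d), e.2), hpos⟩) : Plaquette d L), ?_, ?_⟩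
    · rw [Finset.mem_filter]
      refine ⟨Finset.mem_univ _, rfl, ?_⟩
      show ((e.1 - Pi.single 0 1 : Site d L) 0).val = 0
      rw [Pi.sub_apply, Pi.single_eq_same, eq_one_of_val_eq_one h1, sub_self, ZMod.val_zero]
    · simp [Site.shift]
  · intro p hp
    have hl : IsLowPlaq p := (Finset.mem_filter.1 hp).2
    rw [plaqRe_lowSplice_of_isLowPlaq ρ hL4 hunit V W Y hl]
    simp [shiftDown, Site.shift]

/-! ### Congruences: what the rest of the action and the reference plaquette read -/

omit [TopologicalSpace G] [IsTopologicalGroup G] [CompactSpace G] [MeasurableSpace G] [BorelSpace G] in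
/-- The rest of the action only reads links based at times `t ≠ 0` (`L ≥ 4`). [folklore] -/
theorem restAction_congr (hL4 : 4 ≤ L) {U U' : GaugeConfig d L G}
    (h : ∀ e : Edge d L, (e.1 0).val ≠ 0 → U e = U' e) : restAction ρ U = restAction ρ U' := by
  unfold restAction
  refine Finset.sum_congr rfl fun p hp => ?_
  rw [Finset.mem_filter, Finset.mem_filter] at hp
  obtain ⟨t1, t2, t3, t4⟩ := val_ne_zero_of_rest hL4 hp.1.2 hp.2
  unfold WilsonRP.plaqRe plaquetteHolonomy
  rw [h _ t1, h _ t2, h _ t3, h _ t4]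

omit [NeZero L] [Fact (1 < L)] [TopologicalSpace G] [IsTopologicalGroup G] [CompactSpace G] [MeasurableSpace G]
  [BorelSpace G] in
/-- A spatial plaquette at time `t ≠ 0` only reads links based at times `≠ 0`. [folklore] -/
theorem plaqRe_congr_of_spatial {q : Plaquette d L} (hq : q.2.1.1 ≠ 0) (ht : (q.1 0).val ≠ 0)
    {U U' : GaugeConfig d L G} (h : ∀ e : Edge d L, (e.1 0).val ≠ 0 → U e = U' e) :
    WilsonRP.plaqRe ρ U q = WilsonRP.plaqRe ρ U' q := by
  have hj : q.2.1.2 ≠ 0 := WilsonRP.plaq_snd_ne_zero q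
  unfold WilsonRP.plaqRe plaquetteHolonomy
  rw [h _ ht, h (q.1.shift q.2.1.1, q.2.1.2) (by rw [WilsonRP.val_shift_of_ne _ (Ne.symm hq)]; exact ht),
    h (q.1.shift q.2.1.2, q.2.1.1) (by rw [WilsonRP.val_shift_of_ne _ hj.symm]; exact ht), h _ ht]

omit [Fact (1 < L)] [TopologicalSpace G] [IsTopologicalGroup G] [CompactSpace G] [MeasurableSpace G]
  [BorelSpace G] in
/-- A spatial plaquette at time `1` reads only site-positive links, hence only the second splice
component (`L ≥ 4`). [folklore] -/
theorem plaqRe_splice_sitePos_of_spatial (hL4 : 4 ≤ L) {q : Plaquette d L} (hq : q.2.1.1 ≠ 0)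
    (ht : (q.1 0).val = 1) (V W : GaugeConfig d L G) :
    WilsonRP.plaqRe ρ (LatticeRP.splice WilsonSiteRP.sitePosEdges (V, W)) q = WilsonRP.plaqRe ρ W q := by
  have hj : q.2.1.2 ≠ 0 := WilsonRP.plaq_snd_ne_zero q
  have hmem : ∀ e : Edge d L, (e.1 0).val = 1 →
      LatticeRP.splice WilsonSiteRP.sitePosEdges (V, W) e = W e := fun e he => by
    rw [LatticeRP.splice_apply, if_pos (WilsonSiteRP.mem_sitePosEdges.2 (isSitePosEdge_of_val_eq_one hL4 he))]
  unfold WilsonRP.plaqRe plaquetteHolonomy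
  rw [hmem _ ht, hmem (q.1.shift q.2.1.1, q.2.1.2) (by rw [WilsonRP.val_shift_of_ne _ (Ne.symm hq)]; exact ht),
    hmem (q.1.shift q.2.1.2, q.2.1.1) (by rw [WilsonRP.val_shift_of_ne _ hj.symm]; exact ht), hmem _ ht]

/-! ### The slab functional and its transfer form -/




omit [TopologicalSpace G] [IsTopologicalGroup G] [CompactSpace G] [MeasurableSpace G] [BorelSpace G] in
/-- `shiftDown (bottomConfig A)` agrees with `A` on the slice-one links. [folklore] -/
theorem shiftDown_bottomConfig {A : GaugeConfig d L G} {e : Edge d L}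
    (he : e ∈ (sliceOneEdges : Finset (Edge d L))) : shiftDown (bottomConfig A) e = A e := by
  obtain ⟨hj, h1⟩ := mem_sliceOneEdges.1 he
  have hmem : ((e.1 - Pi.single 0 1, e.2) : Edge d L) ∈ (bottomEdges : Finset (Edge d L)) := by
    rw [mem_bottomEdges]
    refine ⟨hj, ?_⟩
    show ((e.1 - Pi.single 0 1 : Site d L) 0).val = 0
    rw [Pi.sub_apply, Pi.single_eq_same, eq_one_of_val_eq_one h1, sub_self, ZMod.val_zero]
  simp only [shiftDown, bottomConfig, if_pos hmem]
  congr 1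
  simp [Site.shift]

omit [Fact (1 < L)] [TopologicalSpace G] [IsTopologicalGroup G] [CompactSpace G] [MeasurableSpace G]
  [BorelSpace G] in
/-- Spliced configurations over `bottomConfig A` and over the trivial boundary agree at all links
based at times `≠ 0`. [folklore] -/
theorem splice_bottomConfig_eq_of_val_ne_zero (A W : GaugeConfig d L G) {e : Edge d L}
    (he : (e.1 0).val ≠ 0) :
    LatticeRP.splice WilsonSiteRP.sitePosEdges (bottomConfig A, W) e =
      LatticeRP.splice WilsonSiteRP.sitePosEdges ((fun _ => (1 : G)), W) e := by
  simp only [LatticeRP.splice_apply]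
  split_ifs with h
  · rfl
  · have : e ∉ (bottomEdges : Finset (Edge d L)) := fun hb => he (mem_bottomEdges.1 hb).2
    simp only [bottomConfig, if_neg this]

end Transfer

/-- **Registered sub-goal `stub_lowTransferKernel`** (`--supports stmt-QuantumFields-9363`): closed form of `exp_lowAction_lowSplice` — the lowest transfer step is the slice kernel of the slice `t = 1` after a gauge transformation. [folklore] -/
theorem stub_lowTransferKernel : ∀ (d L N : ℕ) [NeZero d] [NeZero L] [Fact (1 < L)] (G : Type) [Group G] [TopologicalSpace G] [IsTopologicalGroup G] [CompactSpace G] [MeasurableSpace G] [BorelSpace G] (ρ : G →* Matrix (Fin N) (Fin N) ℂ), 4 ≤ L → (∀ g, ρ g ∈ Matrix.unitaryGroup (Fin N) ℂ) → ∀ (β : ℝ) (V W Y : Literature.MathematicalPhysics.QuantumFieldTheory.GaugeConfig d L G), Real.exp (β * Summit.QuantumFields.YangMills.Theorems.FemtoCurvatureTwoPoint.StrictRP.lowAction ρ (Summit.QuantumFields.YangMills.Theorems.FemtoCurvatureTwoPoint.StrictRP.lowSplice V W Y)) = Summit.QuantumFields.YangMills.Theorems.FemtoCurvatureTwoPoint.StrictRP.sliceKernel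 ρ β Summit.QuantumFields.YangMills.Theorems.FemtoCurvatureTwoPoint.StrictRP.sliceOneEdges (Summit.QuantumFields.YangMills.Theorems.FemtoCurvatureTwoPoint.StrictRP.shiftDown V) (Literature.MathematicalPhysics.QuantumFieldTheory.gaugeTransform (Summit.QuantumFields.YangMills.Theorems.FemtoCurvatureTwoPoint.StrictRP.gaugeOf Y) W) := by
  intro d L N _ _ _ G _ _ _ _ _ _ ρ hL4 hunit β V W Y
  exact exp_lowAction_lowSplice ρ hL4 hunit β V W Y

end Summit.QuantumFields.YangMills.Theorems.FemtoCurvatureTwoPoint.StrictRP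

end
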